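import Mathlib
import Literature.AlgebraicGeometry.Resolution.ResolutionOfSingularities
import Literature.AlgebraicGeometry.Resolution.ResolutionOfCurves
import Literature.AlgebraicGeometry.Resolution.PrincipalizationToResolution
import HarnessLib

/-!
# Integral curves open-immersed in Γ-schemes are locally resolvable (crux `UniversalCells.MatroidCellRes`, line `birth`)

Stub `stub_curveLocalRes` of the skeleton `Cruxes/MatroidCellRes/Lines/birth.lean` for crux
stmt-ResolutionOfSingularities-15230 (`Summit.ResolutionOfSingularities.ResolutionOfSingularities.Theses.UniversalCells.MatroidCellRes`).
The Γ-scheme `Z_{Γ₀} = Spec (𝔽_p[a_ij : 3 × m] ⧸ (3 × 3 minors of [I₃ | A] indexed by Γ₀))` is written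
out over Mathlib exactly as in the registered signature (the two `let`s of the crux, substituted).

Proof idea. Let `Q = 𝔽_p[a_ij] ⧸ (Γ₀-minors)` and `f : W → Spec 𝔽_p` the structure map
`j ≫ Spec (𝔽_p → Q)`. Then `f` is locally of finite type (an open immersion followed by `Spec` of
the finite-type algebra map `𝔽_p → Q`, `HasRingHomProperty.Spec_iff`), `W` is a Noetherian
topological space (open subspace of the Noetherian space `Spec Q`, `Q` a Noetherian ring), hence
`f` is quasi-compact (`quasiCompact_of_noetherianSpace_source`), and `W` is reduced (integral).
So the in-tree theorem `hasResolution_of_dim_le_one` (reduced curves of finite type over a field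
are resolved by normalisation) gives `Scheme.HasResolution W`, and the neighbourhood `W' = ⊤`
works by `Scheme.HasResolution.restrict`.
-/

noncomputable section

-- single-problem summit: the doubled namespace component `ResolutionOfSingularities` is forced
set_option linter.dupNamespace false

open CategoryTheory AlgebraicGeometry TopologicalSpace Literature.AlgebraicGeometry.Resolution

namespace Summit.ResolutionOfSingularities.ResolutionOfSingularities.Theorems.MatroidCellRes

/-- **(C) Curves** — an integral scheme `W` of dimension `≤ 1` open-immersed (`j`) in the
Γ-scheme `Spec (𝔽_p[a_ij : 3 × m] ⧸ (Γ₀-minors of [I₃ | A]))` has, around each point `w`, an open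
neighbourhood admitting a resolution of singularities; in fact `W' = W` works, since `W` is a
reduced curve of finite type over the field `𝔽_p` and such curves are resolved by normalisation
(`hasResolution_of_dim_le_one`, in tree). [cite: Hartshorne1977, Ch. V Rem. 3.8.1] -/
theorem stub_curveLocalRes (p : ℕ) (hp : p.Prime) (m : ℕ)
    (Γ0 : Set (Fin 3 → Fin 3 ⊕ Fin m)) (W : Scheme.{0})
    (j : W ⟶ Spec (.of (
        MvPolynomial (Fin 3 × Fin m) (ZMod p) ⧸ Ideal.span ((fun u : Fin 3 → Fin 3 ⊕ Fin m => ((Matrix.fromCols (1 : Matrix (Fin 3) (Fin 3) (MvPolynomial (Fin 3 × Fin m) (ZMod p))) (Matrix.of fun i j => MvPolynomial.X (i, j))).submatrix id u).det) '' Γ0))))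
    (hj : IsOpenImmersion j) (hW : IsIntegral W) (hdim : topologicalKrullDim W ≤ 1) (w : W) :
    ∃ W' : W.Opens, w ∈ W' ∧ Scheme.HasResolution (W' : Scheme.{0}) := by
  haveI : Fact p.Prime := ⟨hp⟩
  haveI := hj
  haveI := hW
  -- the structure map `W → Spec 𝔽_p` through the Γ-scheme
  let f : W ⟶ Spec (.of (ZMod p)) :=
    j ≫ Spec.map (CommRingCat.ofHom (algebraMap (ZMod p)
      (MvPolynomial (Fin 3 × Fin m) (ZMod p) ⧸ Ideal.span ((fun u : Fin 3 → Fin 3 ⊕ Fin m =>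
        ((Matrix.fromCols (1 : Matrix (Fin 3) (Fin 3) (MvPolynomial (Fin 3 × Fin m) (ZMod p)))
          (Matrix.of fun i j => MvPolynomial.X (i, j))).submatrix id u).det) '' Γ0))))
  -- `Spec` of the finite-type algebra map `𝔽_p → Q` is locally of finite type
  haveI : LocallyOfFiniteType (Spec.map (CommRingCat.ofHom (algebraMap (ZMod p)
      (MvPolynomial (Fin 3 × Fin m) (ZMod p) ⧸ Ideal.span ((fun u : Fin 3 → Fin 3 ⊕ Fin m =>
        ((Matrix.fromCols (1 : Matrix (Fin 3) (Fin 3) (MvPolynomial (Fin 3 × Fin m) (ZMod p)))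
          (Matrix.of fun i j => MvPolynomial.X (i, j))).submatrix id u).det) '' Γ0))))) := by
    rw [HasRingHomProperty.Spec_iff (P := @LocallyOfFiniteType)]
    exact RingHom.finiteType_algebraMap.mpr inferInstance
  haveI : LocallyOfFiniteType f := inferInstance
  -- `W` is an open subspace of the Noetherian space `Spec Q`, hence Noetherian, so `f` is
  -- quasi-compact (`quasiCompact_of_noetherianSpace_source`)
  haveI : NoetherianSpace W := j.isOpenEmbedding.isInducing.noetherianSpace
  have h : Scheme.HasResolution W := hasResolution_of_dim_le_one W f hdim
  exact ⟨⊤, trivial, h.restrict ⊤⟩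

end Summit.ResolutionOfSingularities.ResolutionOfSingularities.Theorems.MatroidCellRes

end
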